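import Literature.Probability.Percolation.KSTPeriodicBridges
import HarnessLib

/-!
# Stub `kstBridges` of line `finite-size-envelope`, crux `CriticalPathRSW` (stmt-CriticalPhenomena-10267)

STUB 5d — [KohlerSchindlerTassion2023, Lemma 1(i),(iii)] in weak periodic form: for
`kℤ² ⋊ D₄`-periodic positively associated bond measures on `ℤ²` carried by lattice configurations,
bridges give long crossings (`KSTPeriodic.BridgesGiveCrossings k t`,
`Literature/Probability/Percolation/KSTPeriodicStatements.lean`), granted the two planar facts
`KSTPeriodic.ArchesMeet` and `KSTPeriodic.PartsToSegmentsMeet` (stub `kstTopology`).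

The mathematics is the Literature theorem `KSTPeriodic.bridgesGiveCrossings_of`
(`Literature/Probability/Percolation/KSTPeriodicBridges.lean`, constant `c₀ = (b₀/5)^(48ρ+2)`):
decomposition of the bridge event into the left–right crossing and four equally likely corner
events (`KSTPeriodicBridgesParts.lean`), standard gluing of translates of long crossings
(`KSTPeriodicBridgesGlue.lean`), and arches from crossed connections plus "marching arches join
up" for the intersected translates of the arch event (`KSTPeriodicBridgesArch.lean`). The
hypothesis `1 ≤ k` of the registered signature is not needed (`768k ∣ n`, `n ≥ 1` force it).
-/

namespace Summit.CriticalPhenomena.CardyFormulaZ2.Cruxes.CriticalPathRSW.FiniteSizeEnvelope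

open Set MeasureTheory Filter Topology
open Literature.Probability.LatticeModels Literature.Probability.Percolation

/-- STUB 5d — **Lemma 1(i),(iii), weak periodic: bridges give long crossings**: for every
`b₀ > 0` and integer aspect ratio `ρ ≥ 1` there is `c₀ > 0` (namely `(b₀/5)^(48ρ+2)`) such that
for every admissible measure carried by lattice configurations and every scale `n ≥ 1` divisible by
`768k`, `μ(bridge_t(n; n/12)) ≥ b₀` forces `μ(𝓒_t(ρ n, n)) ≥ c₀`; granted `ArchesMeet` and
`PartsToSegmentsMeet`. [cite: KohlerSchindlerTassion2023, Lemma 1(i),(iii) and Comment 1] -/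
theorem stub_kstBridges :
  ∀ k t : ℕ, 1 ≤ k → KSTPeriodic.ArchesMeet → KSTPeriodic.PartsToSegmentsMeet →
    KSTPeriodic.BridgesGiveCrossings k t :=
  fun _ _ _ hAr hPS => KSTPeriodic.bridgesGiveCrossings_of hAr hPS

end Summit.CriticalPhenomena.CardyFormulaZ2.Cruxes.CriticalPathRSW.FiniteSizeEnvelope
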